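import Literature.AlgebraicGeometry.Modules.TensorSheafHomIso
import HarnessLib

/-!
# The tensor–hom adjunction `B ⊗ – ⊣ 𝓗om(B, –)` for `𝒪_X`-modules (Hartshorne II Ex. 5.1 (c))

For `𝒪_X`-modules `A`, `B`, `C` on a scheme `X` (Mathlib's `X.Modules`; the tree's sheafified
tensor product `Modules.tensorObj` of `Modules/TensorProduct.lean`, Stacks 01CA, and internal Hom
`Modules.sheafHom` of `Modules/SheafHom.lean`, Stacks 01CM) we construct the canonical bijection

  `Hom(B ⊗ A, C) ≃ Hom(A, 𝓗om(B, C))`        (`tensorSheafHomEquiv B A C`),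

natural in `A` and `C`, i.e. the adjunction `(tensorBifunctor X).obj B ⊣ sheafHomFunctor B`
(`tensorSheafHomAdj B`): Hartshorne II Ex. 5.1 (c) "For any `𝒪_X`-modules `𝓕`, `𝓖`,
`Hom(𝓔 ⊗ 𝓕, 𝓖) ≅ Hom(𝓕, 𝓗om(𝓔, 𝓖))`" (there for `𝓔` locally free of finite rank; the
statement and the proof below need no hypothesis on `𝓔 = B`), Stacks 01CN = Lemma 17.22.1 ("to
give a morphism `𝓕 ⊗ 𝓖 → 𝓗` is the same as giving a morphism `𝓕 → 𝓗om(𝓖, 𝓗)`"; here with GLOBAL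
`Hom` — the internal version `𝓗om(B ⊗ A, C) ≅ 𝓗om(A, 𝓗om(B, C))`, "sheaf Hom in all three spots",
is not in this file). Construction by unit and counit:

* §1 `tmulHomOfSection B A U a : B|_U ⟶ (B ⊗ A)|_U`, `b ↦ b ⊗ a|` for a section `a ∈ Γ(A, U)`
  (elementary tensors of sections, `Modules/PullbackTensor.tmulSection`), additive and
  `𝒪(U)`-linear in `a`, compatible with restriction;
* §2 the UNIT `tensorSheafHomUnit B A : A ⟶ 𝓗om(B, B ⊗ A)`, `a ↦ (b ↦ b ⊗ a)`;
* §3 the COUNIT `tensorSheafHomCounit B C : B ⊗ 𝓗om(B, C) ⟶ C`, `b ⊗ f ↦ f(b)`: the transpose across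
  the sheafification adjunction (`modulesSheafifyAdjunction`) of the presheaf-level evaluation
  `B(U) ⊗_{𝒪(U)} Hom(B|_U, C|_U) → C(U)` (`evalBilin`, `tensorSheafHomCounitPre`);
* §4 `tensorSheafHomEquiv B A C : (B ⊗ A ⟶ C) ≃ (A ⟶ 𝓗om(B, C))`, `φ ↦ unit ≫ 𝓗om(B, φ)`,
  `ψ ↦ (𝟙 ⊗ ψ) ≫ counit`; the two inverse laws are checked on elementary tensors
  (`Modules/TensorSheafHom.tensorObj_hom_ext`) and on values of local morphisms (`hom_ext_of_appLE`);
  naturality in `A` and `C`; **`tensorSheafHomAdj B : (tensorBifunctor X).obj B ⊣ sheafHomFunctor B`**;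
* §5 consequences: `𝓗om(B, –)` preserves monomorphisms (a right adjoint); for `B` finite locally
  free `B ⊗ –` preserves monomorphisms (it is `≅ 𝓗om(B^∨, –)`, `Modules/TensorSheafHomIso`), hence
  **`injective_sheafHom_of_isFiniteLocallyFree`: `𝓗om(B, J)` is injective for `J` injective and `B`
  finite locally free** (Mathlib `Injective.injective_of_adjoint`) — the input that makes
  `𝓗om•(E•, I•)` a complex of injectives for a strictly perfect `E•`.

Everything is proved; definitions are constructions with bodies; no named fact, no instance, no
notation. Use (Hodge programme, road №4, crux 26512): brick (G1) of the 01CD-general price and brick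
(A2) of the derived-duality price (β3); library only — proves nothing about 26512, №4, HC_AV or HC.

## References

* R. Hartshorne, *Algebraic Geometry*, GTM 52 (1977), II Ex. 5.1 (c) (p. 123). [Hartshorne1977]
* The Stacks Project, Tag 01CN (Modules, Lemma 17.22.1: `Hom(𝓕 ⊗ 𝓖, 𝓗) = Hom(𝓕, 𝓗om(𝓖, 𝓗))`),
  Tag 01CM (internal Hom), Tag 01CA (tensor product). [StacksProject]
-/

noncomputable section

-- `TopCat.Presheaf`/`Scheme.Modules` are not reducible (as in Mathlib's `AlgebraicGeometry/Modules/Sheaf.lean`).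
set_option backward.isDefEq.respectTransparency false

open CategoryTheory AlgebraicGeometry Opposite TopologicalSpace MonoidalCategory
open scoped TensorProduct

universe u

namespace Literature.AlgebraicGeometry.Modules

open Literature.AlgebraicGeometry.Motives

variable {X : Scheme.{u}}

/-! ### §1 The morphism `b ↦ b ⊗ a|` : `B|_U ⟶ (B ⊗ A)|_U` of a section `a ∈ Γ(A, U)` -/

section TmulHom

variable (B A : X.Modules) {U V W : X.Opens}

/-- `0 ⊗ t = 0` for elementary tensors of sections. [cite: StacksProject, Tag 01CA] -/
theorem tmulSection_zero_left (U : X.Opens) (t : secMod A U) :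
    tmulSection B A U 0 t = 0 := by
  rw [tmulSection_def, TensorProduct.zero_tmul, map_zero]

/-- `s ⊗ 0 = 0` for elementary tensors of sections. [cite: StacksProject, Tag 01CA] -/
theorem tmulSection_zero_right (U : X.Opens) (s : secMod B U) :
    tmulSection B A U s 0 = 0 := by
  rw [tmulSection_def, TensorProduct.tmul_zero, map_zero]

/-- **`b ↦ b ⊗ a|_W`**: the morphism `B|_U ⟶ (B ⊗ A)|_U` attached to a section `a ∈ Γ(A, U)`
(on sections over `W ≤ U`: `b ↦ b ⊗ a|_W`, an elementary tensor of sections).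
[cite: Hartshorne1977, II Ex. 5.1 (c)] -/
def tmulHomOfSection (U : X.Opens) (a : Γ(A, U)) : B.over U ⟶ (tensorObj B A).over U where
  val := PresheafOfModules.homMk
    { app := fun W => AddCommGrpCat.ofHom
        { toFun := fun b : Γ(B, W.unop.left) =>
            (tmulSection B A W.unop.left b (A.presheaf.map W.unop.hom.op a) :
              Γ(tensorObj B A, W.unop.left))
          map_zero' := tmulSection_zero_left B A _ _
          map_add' := fun b b' => tmulSection_add_left B A _ b b' _ }
      naturality := fun {W W'} g => by
        refine AddCommGrpCat.ext fun (b : Γ(B, W.unop.left)) => ?_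
        change tmulSection B A W'.unop.left (B.presheaf.map g.unop.left.op b)
            (A.presheaf.map W'.unop.hom.op a) =
          (tensorObj B A).val.map g.unop.left.op
            (tmulSection B A W.unop.left b (A.presheaf.map W.unop.hom.op a))
        rw [val_map_tmulSection]
        change _ = tmulSection B A W'.unop.left (B.presheaf.map g.unop.left.op b)
          (A.presheaf.map g.unop.left.op (A.presheaf.map W.unop.hom.op a))
        rw [presheaf_map_map, Subsingleton.elim (g.unop.left ≫ W.unop.hom) W'.unop.hom] }
    (fun W (r : Γ(X, W.unop.left)) (b : Γ(B, W.unop.left)) => by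
      change tmulSection B A W.unop.left (r • b) (A.presheaf.map W.unop.hom.op a) =
        r • tmulSection B A W.unop.left b (A.presheaf.map W.unop.hom.op a)
      exact tmulSection_smul_left B A _ r b _)

variable {B A}

/-- Values: `(b ↦ b ⊗ a|)(b) = b ⊗ a|_W` for `b ∈ Γ(B, W)`, `W ≤ U`. [cite: Hartshorne1977, II Ex. 5.1 (c)] -/
@[simp]
theorem appLE_tmulHomOfSection (a : Γ(A, U)) (k : W ⟶ U) (b : Γ(B, W)) :
    appLE (tmulHomOfSection B A U a) k b = tmulSection B A W b (A.presheaf.map k.op a) :=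
  rfl

/-- Additivity in `a`. [cite: Hartshorne1977, II Ex. 5.1 (c)] -/
theorem tmulHomOfSection_add (a a' : Γ(A, U)) :
    tmulHomOfSection B A U (a + a') = tmulHomOfSection B A U a + tmulHomOfSection B A U a' := by
  refine hom_ext_of_appLE fun W k b => ?_
  rw [appLE_add, appLE_tmulHomOfSection, appLE_tmulHomOfSection, appLE_tmulHomOfSection, map_add,
    tmulSection_add_right]

/-- `a ↦ (b ↦ b ⊗ a|)` sends `0` to `0`. [cite: Hartshorne1977, II Ex. 5.1 (c)] -/
theorem tmulHomOfSection_zero : tmulHomOfSection B A U (0 : Γ(A, U)) = 0 := by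
  refine hom_ext_of_appLE fun W k b => ?_
  rw [appLE_zero, appLE_tmulHomOfSection, map_zero, tmulSection_zero_right]

/-- `𝒪(U)`-linearity in `a`: `b ⊗ (r a)| = r| • (b ⊗ a|)`. [cite: Hartshorne1977, II Ex. 5.1 (c)] -/
theorem tmulHomOfSection_smul (r : Γ(X, U)) (a : Γ(A, U)) :
    tmulHomOfSection B A U (r • a) = r • tmulHomOfSection B A U a := by
  refine hom_ext_of_appLE fun W k b => ?_
  rw [appLE_smul, appLE_tmulHomOfSection, appLE_tmulHomOfSection, Scheme.Modules.map_smul]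
  exact tmulSection_smul_right B A W _ b _

/-- Restriction: `(b ↦ b ⊗ a|)|_V = (b ↦ b ⊗ (a|_V)|)`. [cite: Hartshorne1977, II Ex. 5.1 (c)] -/
theorem restrictHom_tmulHomOfSection (i : V ⟶ U) (a : Γ(A, U)) :
    restrictHom i (tmulHomOfSection B A U a) = tmulHomOfSection B A V (A.presheaf.map i.op a) := by
  refine hom_ext_of_appLE fun W k b => ?_
  rw [appLE_restrictHom, appLE_tmulHomOfSection, appLE_tmulHomOfSection, presheaf_map_map]

/-- Post-composition with `(𝟙 ⊗ g)|_U`: `(b ↦ b ⊗ a|) ≫ (𝟙_B ⊗ g)|_U = (b ↦ b ⊗ g(a)|)`.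
[cite: Hartshorne1977, II Ex. 5.1 (c)] -/
theorem tmulHomOfSection_comp_over_map {A' : X.Modules} (g : A ⟶ A') (a : Γ(A, U)) :
    tmulHomOfSection B A U a ≫ (SheafOfModules.overFunctor _ U).map (tensorMap (𝟙 B) g) =
      tmulHomOfSection B A' U (g.app U a) := by
  refine hom_ext_of_appLE fun W k b => ?_
  rw [appLE_comp_over_map, appLE_tmulHomOfSection, appLE_tmulHomOfSection, ← app_presheaf_map]
  exact (tensorMap_app_tmulSection (𝟙 B) g W b _).trans (by rw [Scheme.Modules.Hom.id_app]; rfl)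

end TmulHom

/-! ### §2 The unit `A ⟶ 𝓗om(B, B ⊗ A)`, `a ↦ (b ↦ b ⊗ a)` -/

section Unit

variable (B A : X.Modules) {U : X.Opens}

/-- **The unit (coevaluation) `A ⟶ 𝓗om(B, B ⊗ A)`**, `a ↦ (b ↦ b ⊗ a)`.
[cite: Hartshorne1977, II Ex. 5.1 (c)] -/
def tensorSheafHomUnit : A ⟶ sheafHom B (tensorObj B A) where
  val := PresheafOfModules.homMk
    { app := fun U => AddCommGrpCat.ofHom
        { toFun := fun a : Γ(A, U.unop) =>
            (tmulHomOfSection B A U.unop a : Γ(sheafHom B (tensorObj B A), U.unop))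
          map_zero' := tmulHomOfSection_zero
          map_add' := tmulHomOfSection_add }
      naturality := fun {U V} i => by
        refine AddCommGrpCat.ext fun (a : Γ(A, U.unop)) => ?_
        change tmulHomOfSection B A V.unop (A.presheaf.map i.unop.op a) =
          restrictHom i.unop (tmulHomOfSection B A U.unop a)
        rw [restrictHom_tmulHomOfSection] }
    (fun U (r : Γ(X, U.unop)) (a : Γ(A, U.unop)) => tmulHomOfSection_smul r a)

/-- On sections the unit is `a ↦ (b ↦ b ⊗ a|)`. [cite: Hartshorne1977, II Ex. 5.1 (c)] -/
@[simp]
theorem tensorSheafHomUnit_app (a : Γ(A, U)) :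
    (tensorSheafHomUnit B A).app U a = (tmulHomOfSection B A U a : Γ(sheafHom B (tensorObj B A), U)) :=
  rfl

end Unit

/-! ### §3 The counit `B ⊗ 𝓗om(B, C) ⟶ C`, `b ⊗ f ↦ f(b)` -/

section Counit

variable (B C : X.Modules) {U : X.Opens}

/-- The `𝒪(U)`-bilinear evaluation `(b, f) ↦ f_U(b)`, `Γ(B, U) × Hom(B|_U, C|_U) → Γ(C, U)`.
[cite: Hartshorne1977, II Ex. 5.1 (c)] -/
def evalBilinOfSections (U : X.Opens) :
    secMod B U →ₗ[secRing X U] secMod (sheafHom B C) U →ₗ[secRing X U] secMod C U :=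
  LinearMap.mk₂ (secRing X U)
    (fun b f => (appLE (sheafHomSectionsEquiv B C U f) (𝟙 U) b : secMod C U))
    (fun b b' f => appLE_add_right _ _ b b')
    (fun r b f => appLE_smul_right _ _ r b)
    (fun b f f' => appLE_add _ _ _ b)
    (fun (r : Γ(X, U)) b (f : B.over U ⟶ C.over U) => by
      change appLE (r • f) (𝟙 U) b = r • appLE f (𝟙 U) b
      rw [appLE_smul, op_id, X.presheaf.map_id]
      rfl)

/-- Values of `evalBilinOfSections`. [cite: Hartshorne1977, II Ex. 5.1 (c)] -/
theorem evalBilinOfSections_apply (U : X.Opens) (b : secMod B U) (f : B.over U ⟶ C.over U) :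
    evalBilinOfSections B C U b (f : Γ(sheafHom B C, U)) = (appLE f (𝟙 U) b : secMod C U) :=
  rfl

/-- The presheaf-level evaluation `B(U) ⊗_{𝒪(U)} Hom(B|_U, C|_U) → C(U)`, `b ⊗ f ↦ f_U(b)`, natural in
`U`. [cite: Hartshorne1977, II Ex. 5.1 (c)] -/
def tensorSheafHomCounitPre :
    tensorPresheaf B (sheafHom B C) ⟶ (Scheme.Modules.toPresheafOfModules X).obj C where
  app U := ModuleCat.ofHom (Y := secMod C U.unop) (TensorProduct.lift (evalBilinOfSections B C U.unop))
  naturality {U U'} i := by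
    apply ModuleCat.hom_ext
    apply TensorProduct.ext'
    intro b (f : B.over U.unop ⟶ C.over U.unop)
    change TensorProduct.lift (evalBilinOfSections B C U'.unop)
        (resT B (sheafHom B C) i.unop.le (b ⊗ₜ (f : Γ(sheafHom B C, U.unop)))) =
      C.presheaf.map (homOfLE i.unop.le).op (appLE f (𝟙 U.unop) b)
    rw [resT_tmul, TensorProduct.lift.tmul]
    change appLE (restrictHom (homOfLE i.unop.le) f) (𝟙 U'.unop) (res B i.unop.le b) = _
    rw [appLE_restrictHom, ← appLE_map]
    exact appLE_congr_hom f _ _ _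

/-- On elementary tensors the presheaf-level evaluation is `b ⊗ₜ f ↦ f_U(b)`.
[cite: Hartshorne1977, II Ex. 5.1 (c)] -/
theorem tensorSheafHomCounitPre_app_tmul (U : X.Opens) (b : secMod B U) (f : B.over U ⟶ C.over U) :
    (tensorSheafHomCounitPre B C).app (op U) (b ⊗ₜ[secRing X U] (f : Γ(sheafHom B C, U))) =
      (appLE f (𝟙 U) b : secMod C U) :=
  TensorProduct.lift.tmul _ _

/-- **The counit (evaluation) `B ⊗ 𝓗om(B, C) ⟶ C`**, `b ⊗ f ↦ f(b)`: the transpose of the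
presheaf-level evaluation across the sheafification adjunction. [cite: Hartshorne1977, II Ex. 5.1 (c)] -/
def tensorSheafHomCounit : tensorObj B (sheafHom B C) ⟶ C :=
  ((modulesSheafifyAdjunction X).homEquiv _ _).symm (tensorSheafHomCounitPre B C)

/-- Composed with the sheafification unit, the counit is the presheaf-level evaluation.
[cite: Hartshorne1977, II Ex. 5.1 (c)] -/
theorem tensorUnitHom_comp_tensorSheafHomCounit :
    tensorUnitHom B (sheafHom B C) ≫
        (Scheme.Modules.toPresheafOfModules X).map (tensorSheafHomCounit B C) =
      tensorSheafHomCounitPre B C := by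
  unfold tensorSheafHomCounit tensorUnitHom
  rw [← Adjunction.homEquiv_unit, Equiv.apply_symm_apply]

/-- **Section formula `ε(b ⊗ f) = f_U(b)`.** [cite: Hartshorne1977, II Ex. 5.1 (c)] -/
theorem tensorSheafHomCounit_app_tmulSection (U : X.Opens) (b : secMod B U) (f : B.over U ⟶ C.over U) :
    (tensorSheafHomCounit B C).app U (tmulSection B (sheafHom B C) U b (f : Γ(sheafHom B C, U))) =
      appLE f (𝟙 U) b := by
  rw [tmulSection_def, ← tensorSheafHomCounitPre_app_tmul, ← tensorUnitHom_comp_tensorSheafHomCounit]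
  rfl

end Counit

/-! ### §4 The bijection `Hom(B ⊗ A, C) ≃ Hom(A, 𝓗om(B, C))` and the adjunction -/

section Adjunction

variable (B A C : X.Modules) {A' C' : X.Modules}

/-- **`Hom(B ⊗ A, C) ≃ Hom(A, 𝓗om(B, C))`** (Hartshorne II Ex. 5.1 (c); Stacks 01CN, Lemma 17.22.1):
`φ ↦ (a ↦ (b ↦ φ(b ⊗ a)))` with inverse `ψ ↦ (b ⊗ a ↦ ψ(a)(b))`, written as
`φ ↦ unit ≫ 𝓗om(B, φ)` and `ψ ↦ (𝟙_B ⊗ ψ) ≫ counit`.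
[cite: Hartshorne1977, II Ex. 5.1 (c) (p. 123)] [cite: StacksProject, Tag 01CN (Lemma 17.22.1)] -/
def tensorSheafHomEquiv : (tensorObj B A ⟶ C) ≃ (A ⟶ sheafHom B C) where
  toFun φ := tensorSheafHomUnit B A ≫ sheafHomMap B φ
  invFun ψ := tensorMap (𝟙 B) ψ ≫ tensorSheafHomCounit B C
  left_inv φ := by
    refine tensorObj_hom_ext fun U b a => ?_
    rw [Scheme.Modules.Hom.comp_app, CategoryTheory.comp_apply, tensorMap_app_tmulSection,
      Scheme.Modules.Hom.id_app, CategoryTheory.id_apply, Scheme.Modules.Hom.comp_app,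
      CategoryTheory.comp_apply, tensorSheafHomUnit_app, sheafHomMap_app_apply,
      tensorSheafHomCounit_app_tmulSection, appLE_comp_over_map, appLE_tmulHomOfSection, op_id,
      A.presheaf.map_id]
    rfl
  right_inv ψ := by
    refine Scheme.Modules.hom_ext _ _ fun U => ?_
    ext a
    rw [Scheme.Modules.Hom.comp_app, CategoryTheory.comp_apply, tensorSheafHomUnit_app,
      sheafHomMap_app_apply]
    change (tmulHomOfSection B A U a ≫ (SheafOfModules.overFunctor _ U).map
        (tensorMap (𝟙 B) ψ ≫ tensorSheafHomCounit B C) : Γ(sheafHom B C, U)) =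
      ((sheafHomSectionsEquiv B C U (ψ.app U a) : B.over U ⟶ C.over U) : Γ(sheafHom B C, U))
    refine hom_ext_of_appLE fun W k b => ?_
    rw [appLE_comp_over_map, appLE_tmulHomOfSection, Scheme.Modules.Hom.comp_app,
      CategoryTheory.comp_apply, tensorMap_app_tmulSection, Scheme.Modules.Hom.id_app,
      CategoryTheory.id_apply, app_presheaf_map]
    change (tensorSheafHomCounit B C).app W (tmulSection B (sheafHom B C) W b
        ((restrictHom k (sheafHomSectionsEquiv B C U (ψ.app U a)) : Γ(sheafHom B C, W)))) = _
    rw [tensorSheafHomCounit_app_tmulSection, appLE_restrictHom]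
    exact appLE_congr_hom _ _ _ b

variable {B A C}

/-- Unfolding `tensorSheafHomEquiv`: `φ ↦ unit ≫ 𝓗om(B, φ)`. [cite: Hartshorne1977, II Ex. 5.1 (c)] -/
theorem tensorSheafHomEquiv_apply (φ : tensorObj B A ⟶ C) :
    tensorSheafHomEquiv B A C φ = tensorSheafHomUnit B A ≫ sheafHomMap B φ := rfl

/-- Unfolding the inverse: `ψ ↦ (𝟙_B ⊗ ψ) ≫ counit`. [cite: Hartshorne1977, II Ex. 5.1 (c)] -/
theorem tensorSheafHomEquiv_symm_apply (ψ : A ⟶ sheafHom B C) :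
    (tensorSheafHomEquiv B A C).symm ψ = tensorMap (𝟙 B) ψ ≫ tensorSheafHomCounit B C := rfl

/-- **Section formula** for the transpose: `(φ♯(a))(b) = φ(b ⊗ a|)` — the local morphism
`φ♯_U(a) : B|_U ⟶ C|_U` is `(b ↦ b ⊗ a|) ≫ φ|_U`. [cite: Hartshorne1977, II Ex. 5.1 (c)] -/
theorem tensorSheafHomEquiv_app (φ : tensorObj B A ⟶ C) (U : X.Opens) (a : Γ(A, U)) :
    (tensorSheafHomEquiv B A C φ).app U a =
      ((tmulHomOfSection B A U a ≫ (SheafOfModules.overFunctor _ U).map φ :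
        B.over U ⟶ C.over U) : Γ(sheafHom B C, U)) :=
  rfl

/-- Values of the transpose: `appLE (φ♯(a)) k b = φ(b ⊗ a|_W)`. [cite: Hartshorne1977, II Ex. 5.1 (c)] -/
theorem appLE_tensorSheafHomEquiv_app (φ : tensorObj B A ⟶ C) (U : X.Opens) (a : Γ(A, U))
    {W : X.Opens} (k : W ⟶ U) (b : Γ(B, W)) :
    appLE (sheafHomSectionsEquiv B C U ((tensorSheafHomEquiv B A C φ).app U a)) k b =
      φ.app W (tmulSection B A W b (A.presheaf.map k.op a)) :=
  rfl

/-- **Section formula** for the inverse transpose on elementary tensors: `ψ♭(b ⊗ a) = (ψ(a))_U(b)`.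
[cite: Hartshorne1977, II Ex. 5.1 (c)] -/
theorem tensorSheafHomEquiv_symm_app_tmulSection (ψ : A ⟶ sheafHom B C) (U : X.Opens)
    (b : secMod B U) (a : secMod A U) :
    ((tensorSheafHomEquiv B A C).symm ψ).app U (tmulSection B A U b a) =
      appLE (sheafHomSectionsEquiv B C U (ψ.app U a)) (𝟙 U) b := by
  rw [tensorSheafHomEquiv_symm_apply, Scheme.Modules.Hom.comp_app, CategoryTheory.comp_apply,
    tensorMap_app_tmulSection, Scheme.Modules.Hom.id_app, CategoryTheory.id_apply]
  exact tensorSheafHomCounit_app_tmulSection B C U b _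

/-- Naturality in `C`: `(φ ≫ g)♯ = φ♯ ≫ 𝓗om(B, g)`. [cite: Hartshorne1977, II Ex. 5.1 (c)] -/
theorem tensorSheafHomEquiv_naturality_right (φ : tensorObj B A ⟶ C) (g : C ⟶ C') :
    tensorSheafHomEquiv B A C' (φ ≫ g) = tensorSheafHomEquiv B A C φ ≫ sheafHomMap B g := by
  rw [tensorSheafHomEquiv_apply, tensorSheafHomEquiv_apply, sheafHomMap_comp, Category.assoc]

/-- Naturality in `A`: `(f ≫ ψ)♭ = (𝟙_B ⊗ f) ≫ ψ♭`. [cite: Hartshorne1977, II Ex. 5.1 (c)] -/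
theorem tensorSheafHomEquiv_symm_naturality_left (f : A' ⟶ A) (ψ : A ⟶ sheafHom B C) :
    (tensorSheafHomEquiv B A' C).symm (f ≫ ψ) =
      tensorMap (𝟙 B) f ≫ (tensorSheafHomEquiv B A C).symm ψ := by
  rw [tensorSheafHomEquiv_symm_apply, tensorSheafHomEquiv_symm_apply, ← Category.assoc,
    ← tensorMap_comp, Category.comp_id]

variable (B)

/-- **The tensor–hom adjunction `B ⊗ – ⊣ 𝓗om(B, –)`** on `Mod(𝒪_X)` (Hartshorne II Ex. 5.1 (c),
Stacks 01CN), assembled from `tensorSheafHomEquiv` and its naturality (Mathlib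
`Adjunction.mkOfHomEquiv`). [cite: Hartshorne1977, II Ex. 5.1 (c) (p. 123)] [cite: StacksProject, Tag 01CN (Lemma 17.22.1)] -/
def tensorSheafHomAdj : (tensorBifunctor X).obj B ⊣ sheafHomFunctor B :=
  Adjunction.mkOfHomEquiv
    { homEquiv := fun A C => tensorSheafHomEquiv B A C
      homEquiv_naturality_left_symm := fun f ψ => tensorSheafHomEquiv_symm_naturality_left f ψ
      homEquiv_naturality_right := fun φ g => tensorSheafHomEquiv_naturality_right φ g }

/-- The hom-set bijection of the adjunction is `tensorSheafHomEquiv`. [cite: Hartshorne1977, II Ex. 5.1 (c)] -/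
theorem tensorSheafHomAdj_homEquiv (A C : X.Modules) :
    (tensorSheafHomAdj B).homEquiv A C = tensorSheafHomEquiv B A C := by
  ext φ
  simp [tensorSheafHomAdj]

/-- `B ⊗ –` is a left adjoint. [cite: Hartshorne1977, II Ex. 5.1 (c)] -/
theorem isLeftAdjoint_tensorBifunctor_obj : ((tensorBifunctor X).obj B).IsLeftAdjoint :=
  (tensorSheafHomAdj B).isLeftAdjoint

/-- `𝓗om(B, –)` is a right adjoint. [cite: Hartshorne1977, II Ex. 5.1 (c)] -/
theorem isRightAdjoint_sheafHomFunctor : (sheafHomFunctor B).IsRightAdjoint :=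
  (tensorSheafHomAdj B).isRightAdjoint

end Adjunction

/-! ### §5 Consequences: `𝓗om(B, –)` preserves monomorphisms; `𝓗om(B, J)` is injective for `B`
finite locally free and `J` injective -/

section Injective

variable (B : X.Modules)

/-- `𝓗om(B, –)` preserves monomorphisms (it is a right adjoint). [cite: Hartshorne1977, II Ex. 5.1 (c)] -/
theorem preservesMonomorphisms_sheafHomFunctor : (sheafHomFunctor B).PreservesMonomorphisms :=
  Functor.preservesMonomorphisms_of_adjunction (tensorSheafHomAdj B)

variable {B}

/-- **For `B` finite locally free, `B ⊗ –` preserves monomorphisms** (`B ⊗ – ≅ 𝓗om(B^∨, –)`,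
`Modules/TensorSheafHomIso.tensorSheafHomDualNatIso`, and `𝓗om(B^∨, –)` is a right adjoint): `B` is
flat. [cite: Hartshorne1977, II Ex. 5.1 (b)–(c)] -/
theorem preservesMonomorphisms_tensorBifunctor_obj (hB : IsFiniteLocallyFree B) :
    ((tensorBifunctor X).obj B).PreservesMonomorphisms :=
  haveI := preservesMonomorphisms_sheafHomFunctor (dual B)
  Functor.preservesMonomorphisms.of_iso (tensorSheafHomDualNatIso B hB).symm

/-- **`𝓗om(B, J)` is injective for `B` finite locally free and `J` an injective `𝒪_X`-module**: the
right adjoint `𝓗om(B, –)` of the mono-preserving `B ⊗ –` preserves injective objects (Mathlib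
`Injective.injective_of_adjoint`). This makes `𝓗om•(E•, I•)` a complex of injectives for a strictly
perfect `E•` and a complex of injectives `I•`. [cite: Hartshorne1977, II Ex. 5.1 (c) and III.6 (proof of Prop. 6.7)] -/
theorem injective_sheafHom_of_isFiniteLocallyFree (hB : IsFiniteLocallyFree B) (J : X.Modules)
    [Injective J] : Injective (sheafHom B J) :=
  haveI := preservesMonomorphisms_tensorBifunctor_obj hB
  Injective.injective_of_adjoint (tensorSheafHomAdj B) J

end Injective

end Literature.AlgebraicGeometry.Modules

end
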